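import Summits.ABC.IUTFork.LDHWitness
import HarnessLib

/-!
# The fork at [IUTchIII] Corollary 3.12, L-DH level: the ESTIMATE side in the two valuation-line witnesses
# (non-vacuity of `EstimateDH`, and what it costs in the model where (1.1) holds)

Record-only file (D-0012) of the abc-iut cell (campaign-S seat abc-iut-S2, gen 2; `plan/D9PRIME-OBLIGATIONS.md`
row O4); TAKES NO SIDE. abc-iut-c312-3's `LDHWitness.lean` builds, over the valuation line `valLine F` and ANY
pilot data `X`, two Dupuy–Hilado data: `shellWitness X` — `(O_𝕃(−P_Θ))^{Ind3} := I = O`, the largest region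
the bound (4.10) (read with `0 ∈ ℕ`) allows, in which (1.1) `Cor312DH` HOLDS (`cor312DH_shellWitness`) — and
`bareWitness X` — no (Ind3) enlargement, in which (1.1) FAILS when every prime under `S` has one place over it
(`not_cor312DH_bareWitness`). The L-DH ESTIMATE `DHData.EstimateDH δ` ("`ln ν̄_𝕃(hull(U_Θ)) ≤
ln ν̄_𝕃(O_𝕃(−P_Θ)) + δ`", `LDHCor312.lean`; "[IUTchIV] Thm. 1.10 Steps (iv)–(x) would supply `δ`") is the
hypothesis that the cell's assembly files (`LDHEstimateAssembly`, abc-iut-S2) reduce to per-summand bounds.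
This file computes it in the two witnesses:

* `estimateDH_shellWitness_iff` — in witness A, `EstimateDH δ ↔ deĝ̲_lgp(P_Θ) ≤ δ`: where (1.1) holds by
  taking the (Ind3)-region to be the whole log-shell, the estimate holds ONLY with a discrepancy at least the
  ENTIRE normalised lgp-degree of the theta pilot — so the squeeze `ndeg_qPilot_le_of_squeeze`
  (`deĝ̲(P_q) ≤ δ/(w̄−1)`) is fed a `δ ≥ w̄·deĝ̲(P_q)` and bounds nothing (`squeeze_vacuous_shellWitness`);
* `estimateDH_bareWitness_zero` — in witness B (one place over each prime under `S`), `EstimateDH 0` holds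
  (no inflation at all) while (1.1) fails: the estimate hypothesis is satisfiable with the SHARPEST possible
  `δ = 0`, non-vacuously and independently of (1.1);
* `estimateDH_independent_of_cor312DH` — over `ℚ` both situations occur (c312-3's `exists_pilotData_rat`).
So at the L-DH level the datum `(O_𝕃(−P_Θ))^{Ind3}` decides BOTH sides of the squeeze in opposite
directions: the kernel form of row O4 ("(Ind3) sharpness") of the obligations table. Nothing here bears on
what (Ind3) IS for Mochizuki's objects ([IUTchIII] Thm. 3.11 (ii)); [Dupuy2020c] is where Dupuy–Hilado defer it.
[cite: DupuyHilado2025, §1 (1.1), §4.10–4.12] [claim: Mochizuki2012, status: disputed]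
-/

noncomputable section

namespace Summit.ABC.IUTFork

namespace ValLine

open Set Finset Literature.IUT.LogVolume NumberField IsDedekindDomain

variable {F : Type} [Field F] [NumberField F] (X : PilotData F)

/-! ## Witness A: the estimate costs the whole theta degree -/

/-- In witness A, `−|log(Θ)|_DH = ln ν̄_𝕃(O) = 0`. [cite: DupuyHilado2025, §4.10–4.12] -/
theorem negLogThetaDH_shellWitness : (shellWitness X).negLogThetaDH = 0 := by
  show (valLine F).lnνL X.lstar (primesUnder X) ((valLine F).hullUTheta (ind3Shell X)) = 0
  rw [hullUTheta_shell]
  refine Finset.sum_eq_zero fun p _ => ?_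
  rw [PacketModel.lnνLp, Finset.sum_eq_zero (fun i _ => (valLine F).lnνTensorPower_O p _), mul_zero]

/-- **In witness A, `EstimateDH δ ↔ deĝ̲_lgp(P_Θ) ≤ δ`**: with the (Ind3)-region taken to be the whole
log-shell, the multiradial estimate holds only with a discrepancy at least the full normalised lgp-degree of
the theta pilot (`ln ν̄_𝕃(O_𝕃(−P_Θ)) = −deĝ̲_lgp(P_Θ)`, Thm. 3.10.1). [claim: Mochizuki2012, status: disputed] -/
theorem estimateDH_shellWitness_iff (δ : ℝ) :
    (shellWitness X).EstimateDH δ ↔ LgpDivisor.ndegLgp X.thetaPilot ≤ δ := by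
  unfold DHData.EstimateDH
  rw [negLogThetaDH_shellWitness]
  have hΘ : (valLine F).lnνL X.lstar (primesUnder X) ((valLine F).region (tΘ X)) =
      -LgpDivisor.ndegLgp X.thetaPilot := (shellWitness X).lnνL_regionΘ
  change (0 : ℝ) ≤ (valLine F).lnνL X.lstar (primesUnder X) ((valLine F).region (tΘ X)) + δ ↔ _
  rw [hΘ]
  constructor <;> intro h <;> linarith

/-- In particular the estimate FAILS in witness A for every `δ < deĝ̲_lgp(P_Θ)` — e.g. for `δ = 0`, since
`deĝ̲_lgp(P_Θ) > deĝ̲(P_q) > 0`. [claim: Mochizuki2012, status: disputed] -/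
theorem not_estimateDH_shellWitness_zero : ¬ (shellWitness X).EstimateDH 0 := by
  rw [estimateDH_shellWitness_iff]
  have h1 : FinDivisor.ndeg F X.qPilot < LgpDivisor.ndegLgp X.thetaPilot :=
    (shellWitness X).ndeg_qPilot_lt_ndegLgp_thetaPilot
  have h2 : 0 < FinDivisor.ndeg F X.qPilot := by
    rw [FinDivisor.ndeg_apply]
    exact div_pos X.deg_qPilot_pos FinDivisor.finrank_pos
  change ¬ LgpDivisor.ndegLgp X.thetaPilot ≤ 0
  linarith

/-- **The squeeze is vacuous in witness A**: (1.1) holds there, and any `δ` for which the estimate holds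
satisfies `δ ≥ deĝ̲_lgp(P_Θ) = w̄·deĝ̲(P_q)` — so `gap_le_of_cor312DH_of_estimateDH` returns
`deĝ̲_lgp(P_Θ) − deĝ̲(P_q) ≤ δ`, an inequality already implied by `δ ≥ deĝ̲_lgp(P_Θ)` and `deĝ̲(P_q) ≥ 0`.
[claim: Mochizuki2012, status: disputed] -/
theorem squeeze_vacuous_shellWitness {δ : ℝ} (h : (shellWitness X).EstimateDH δ) :
    LgpDivisor.ndegLgp X.thetaPilot ≤ δ ∧ 0 ≤ FinDivisor.ndeg F X.qPilot := by
  refine ⟨(estimateDH_shellWitness_iff X δ).mp h, ?_⟩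
  rw [FinDivisor.ndeg_apply]
  exact div_nonneg X.deg_qPilot_pos.le FinDivisor.finrank_pos.le

/-! ## Witness B: the estimate holds with `δ = 0` while (1.1) fails -/

/-- In witness B, when every prime under `S` has a single place of `F` over it, the hull of `U_Θ` IS the
bare region over `T`: `−|log(Θ)|_DH = ln ν̄_𝕃(O_𝕃(−P_Θ))`. [cite: DupuyHilado2025, §4.10–4.12] -/
theorem negLogThetaDH_bareWitness (h : ∀ p ∈ primesUnder X, ∀ v w : placesOver F p, v = w) :
    (bareWitness X).negLogThetaDH =
      (valLine F).lnνL X.lstar (primesUnder X) ((valLine F).region (tΘ X)) := by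
  show (valLine F).lnνL X.lstar (primesUnder X) ((valLine F).hullUTheta (ind3Bare X)) = _
  unfold PacketModel.lnνL
  refine Finset.sum_congr rfl fun p hp => lnνLp_congr _ _ fun j e => ?_
  rw [hullUTheta_bare, region_eq_rayEnd]
  congr 1
  have hconst : (fun σ : Equiv.Perm (Fin (j + 1)) => rayEnd (tΘ X) p j (e ∘ σ)) =
      fun _ => rayEnd (tΘ X) p j e := by
    funext σ; rw [comp_perm_eq_of_subsingleton (h p hp)]
  rw [hconst]
  exact Finset.inf'_const _ _

/-- **In witness B the estimate holds with `δ = 0`** (one place over each prime under `S`): no (Ind3)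
enlargement, (Ind1)/(Ind2) move nothing, the hull adds nothing. [claim: Mochizuki2012, status: disputed] -/
theorem estimateDH_bareWitness_zero (h : ∀ p ∈ primesUnder X, ∀ v w : placesOver F p, v = w) :
    (bareWitness X).EstimateDH 0 := by
  unfold DHData.EstimateDH
  rw [negLogThetaDH_bareWitness X h, add_zero]
  exact le_rfl

/-- … while (1.1) fails there (c312-3's `not_cor312DH_bareWitness`): the estimate side and the inequality
side of the squeeze are decided in OPPOSITE directions by the choice of the (Ind3)-region.
[claim: Mochizuki2012, status: disputed] -/
theorem estimateDH_and_not_cor312DH_bareWitness (h : ∀ p ∈ primesUnder X, ∀ v w : placesOver F p, v = w) :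
    (bareWitness X).EstimateDH 0 ∧ ¬ (bareWitness X).Cor312DH :=
  ⟨estimateDH_bareWitness_zero X h, not_cor312DH_bareWitness X h⟩

/-- … and in witness A the other way round: (1.1) holds and the estimate with `δ = 0` fails.
[claim: Mochizuki2012, status: disputed] -/
theorem cor312DH_and_not_estimateDH_shellWitness :
    (shellWitness X).Cor312DH ∧ ¬ (shellWitness X).EstimateDH 0 :=
  ⟨cor312DH_shellWitness X, not_estimateDH_shellWitness_zero X⟩

end ValLine

/-! ## Over `ℚ` both occur -/

/-- **The L-DH estimate is independent of the L-DH typing, oppositely to (1.1)**: over `ℚ` there are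
Dupuy–Hilado data with `EstimateDH 0 ∧ ¬Cor312DH` and Dupuy–Hilado data (same pilot data) with
`Cor312DH ∧ ¬EstimateDH 0` — UNCONDITIONALLY (pilot data from `LDHWitness.exists_pilotData_rat`).
[claim: Mochizuki2012, status: disputed] -/
theorem estimateDH_independent_of_cor312DH :
    (∃ D : DHData ℚ, D.EstimateDH 0 ∧ ¬ D.Cor312DH) ∧ (∃ D : DHData ℚ, D.Cor312DH ∧ ¬ D.EstimateDH 0) := by
  obtain ⟨X, hX⟩ := ValLine.exists_pilotData_rat
  exact ⟨⟨ValLine.bareWitness X, ValLine.estimateDH_and_not_cor312DH_bareWitness X hX⟩,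
    ⟨ValLine.shellWitness X, ValLine.cor312DH_and_not_estimateDH_shellWitness X⟩⟩

end Summit.ABC.IUTFork

end
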